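import Mathlib
import Summits.CriticalPhenomena.PercolationContinuityZ3.Theorems.PercNearOneGluingNoHeavyLowerTailFatMinorityOnePortTarget
import Summits.CriticalPhenomena.PercolationContinuityZ3.Theorems.PercNearOneGluingNoHeavyLowerTailFatMinorityCellSlack
import HarnessLib

/-!
# `NoHeavyLowerTail` (stmt-CriticalPhenomena-4575), line fat-minority-linear — the HYBRID one-port certificate
# (route task `nh-dp-fatminority`, gen 9; FINDINGS-fat-minority-gen9 §5d, conjecture (H-v₀))

Setting of `…FatMinorityOnePortCertificate` / `…OnePortTarget` (`μ = prodBernoulli w` on the pairs of `Fin n`, observer `o` isolated in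
`G ∖ A`, up-set `𝒰 ⊆ 𝒫(A)` generating `U`, a port `a ∈ A`, `e = s(o,a)`, `U^a = {e open} ∩ U`, `μ₁ = μ_{w[e↦1]}`, `D = {c ↮ a}`),
plus an ANCHOR `a₀ ≠ o` lying below some member of every star in `G ∖ {o}` (e.g. Kozma–Nitzan's `argmin_A R'`).

The cells of `U` avoiding the port `a` obey TWO proved bounds — Lemma 5 with slack (`cells_le_slack`) and Lemma 5 proper against the
anchor (`μ({a₀↔b} ∩ σ_B) ≤ μ({o↔b} ∩ σ_B)`, tree `KozmaNitzan2024_lemma5_fintype`) — hence their minimum, cell by cell: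
* `offPort_cells_hybrid`:
  `μ({c↔b} ∩ U ∩ {e closed}) − μ({o↔b} ∩ U ∩ {e closed}) ≤ Σ_{B∈𝒰, a∉B} min( (R'(c) − R'(v B))⁺ μ(σ_B), μ({c↔b} ∩ σ_B) − μ({a₀↔b} ∩ σ_B) )`.
* `upsetStar_of_hybridCertificate`: if `0 < μ₁(D)` and the HYBRID CERTIFICATE INEQUALITY at the port `a` holds —
  `μ₁(D)·Σ_{B∈𝒰,a∉B} min(…) ≤ μ₁(D)·t·μ(U) + w(e)·μ₁(D ∩ U^a)·(μ₁(a↔b) − μ₁(c↔b))` — then `μ({c↔b} ∩ U) − μ({o↔b} ∩ U) ≤ t·μ(U)`.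
Conjecture (H-v₀) of the notes: in 'Case II' the hybrid certificate holds at the worst port `a = v₀ = argmin_A μ(·↔b)` with
`t = (μ(c↔b) − μ(v₀↔b))⁺` (0 failures in ≈4·10⁵ sampled and ≈10³ adversarially annealed instances; the plain certificate at `v₀` or at
`a₀` is refuted).  No new definitions.
-/

namespace Summit.CriticalPhenomena.PercolationContinuityZ3.Theorems

open MeasureTheory Set
open Literature.Probability.LatticeModels (prodBernoulli)
open Literature.Probability.Percolation

noncomputable section
open scoped Classical

variable {n : ℕ}

/-- **Cells avoiding the port: the hybrid (minimum) bound.**  For `B ∈ 𝒰` with `a ∉ B`, a selector `v B ∈ B`, and an anchor `a₀ ≠ o` with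
`R'(a₀) ≤ R'(u B)` for some `u B ∈ B` (`R'` = reliability off `o`):
`μ({c↔b} ∩ U ∩ {e closed}) − μ({o↔b} ∩ U ∩ {e closed}) ≤ Σ_{B ∈ 𝒰, a ∉ B} min( (R'(c) − R'(v B))⁺ μ(σ_B), μ({c↔b} ∩ σ_B) − μ({a₀↔b} ∩ σ_B) )`.
[cite: KozmaNitzan2024, Lemma 5 p. 13 (with and without slack)] -/
theorem offPort_cells_hybrid (w : Sym2 (Fin n) → unitInterval) (A : Finset (Fin n))
    (o a c b a₀ : Fin n) (hoA : o ∉ A) (haA : a ∈ A) (hco : c ≠ o) (ha₀o : a₀ ≠ o)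
    (hiso : ∀ u, u ≠ o → u ∉ A → w s(o, u) = 0)
    (𝒰 : Finset (Finset (Fin n))) (h𝒰A : 𝒰 ⊆ A.powerset)
    (hup : ∀ B ∈ 𝒰, ∀ B' ∈ A.powerset, B ⊆ B' → B' ∈ 𝒰)
    (v : Finset (Fin n) → Fin n) (hv : ∀ B ∈ 𝒰, a ∉ B → v B ∈ B)
    (u : Finset (Fin n) → Fin n) (hu : ∀ B ∈ 𝒰, a ∉ B → u B ∈ B)
    (hanchor : ∀ B ∈ 𝒰, a ∉ B → (prodBernoulli w).real (openConnIn ({o}ᶜ : Set (Fin n)) a₀ b) ≤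
      (prodBernoulli w).real (openConnIn ({o}ᶜ : Set (Fin n)) (u B) b)) :
    (prodBernoulli w).real (openConn c b ∩ {ω | ∃ B ∈ 𝒰, ∀ u ∈ B, s(o, u) ∈ ω} ∩ {ω | s(o, a) ∉ ω}) -
        (prodBernoulli w).real (openConn o b ∩ {ω | ∃ B ∈ 𝒰, ∀ u ∈ B, s(o, u) ∈ ω} ∩ {ω | s(o, a) ∉ ω}) ≤
      ∑ B ∈ 𝒰.filter (fun B => a ∉ B),
        min (max 0 ((prodBernoulli w).real (openConnIn ({o}ᶜ : Set (Fin n)) c b) -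
              (prodBernoulli w).real (openConnIn ({o}ᶜ : Set (Fin n)) (v B) b)) *
            (prodBernoulli w).real (starEvent o (↑B : Set (Fin n))))
          ((prodBernoulli w).real (openConn c b ∩ starEvent o (↑B : Set (Fin n))) -
            (prodBernoulli w).real (openConn a₀ b ∩ starEvent o (↑B : Set (Fin n)))) := by
  rw [real_inter_upEvent_edgeClosed_eq_sum w A o a hoA haA hiso 𝒰 h𝒰A hup (openConn c b),
    real_inter_upEvent_edgeClosed_eq_sum w A o a hoA haA hiso 𝒰 h𝒰A hup (openConn o b),
    ← Finset.sum_sub_distrib]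
  refine Finset.sum_le_sum fun B hB => ?_
  obtain ⟨hB𝒰, haB⟩ := Finset.mem_filter.1 hB
  refine le_min ?_ ?_
  · -- Lemma 5 with slack (one-cell case of `cells_le_slack`)
    have hvB : v B ∈ B := hv B hB𝒰 haB
    have hvA : v B ∈ A := Finset.mem_powerset.1 (h𝒰A hB𝒰) hvB
    have hvo : v B ≠ o := fun h => hoA (h ▸ hvA)
    have h := cells_le_slack w o c b hco {B} v (fun B' hB' => by
      rw [Finset.mem_singleton] at hB'; subst hB'; exact hvB) (fun B' hB' => by
      rw [Finset.mem_singleton] at hB'; subst hB'; exact hvo)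
    simpa using h
  · -- Lemma 5 proper against the anchor: μ(a₀b ∩ σ_B) ≤ μ(ob ∩ σ_B)
    have huB : u B ∈ B := hu B hB𝒰 haB
    have huA : u B ∈ A := Finset.mem_powerset.1 (h𝒰A hB𝒰) huB
    have huo : u B ≠ o := fun h => hoA (h ▸ huA)
    have h5 := KozmaNitzan2024_lemma5_fintype w o b a₀ (u B) (↑B : Set (Fin n)) ha₀o huo
      (Finset.mem_coe.2 huB) (hanchor B hB𝒰 haB)
    linarith

/-- **The up-set star inequality from a HYBRID one-port certificate.**  With the notation of the module docstring: if `0 < μ₁(D)` and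
`μ₁(D) · Σ_{B∈𝒰,a∉B} min((R'(c) − R'(v B))⁺ μ(σ_B), μ({c↔b}∩σ_B) − μ({a₀↔b}∩σ_B)) ≤ μ₁(D)·t·μ(U) + w(e)·μ₁(D ∩ U^a)·(μ₁(a↔b) − μ₁(c↔b))`,
then `μ({c↔b} ∩ U) − μ({o↔b} ∩ U) ≤ t·μ(U)`.  [cite: KozmaNitzan2024, Lemma 3 p. 6, Lemma 5 p. 13; VandenbergHaggstromKahn2005, Thm. 1.5;
combination: route notes gen 9 (H-v₀)] -/
theorem upsetStar_of_hybridCertificate (w : Sym2 (Fin n) → unitInterval) (A : Finset (Fin n))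
    (o a c b a₀ : Fin n) (hoA : o ∉ A) (haA : a ∈ A) (hco : c ≠ o) (ha₀o : a₀ ≠ o)
    (hiso : ∀ u, u ≠ o → u ∉ A → w s(o, u) = 0)
    (𝒰 : Finset (Finset (Fin n))) (h𝒰A : 𝒰 ⊆ A.powerset)
    (hup : ∀ B ∈ 𝒰, ∀ B' ∈ A.powerset, B ⊆ B' → B' ∈ 𝒰)
    (v : Finset (Fin n) → Fin n) (hv : ∀ B ∈ 𝒰, a ∉ B → v B ∈ B)
    (u : Finset (Fin n) → Fin n) (hu : ∀ B ∈ 𝒰, a ∉ B → u B ∈ B)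
    (hanchor : ∀ B ∈ 𝒰, a ∉ B → (prodBernoulli w).real (openConnIn ({o}ᶜ : Set (Fin n)) a₀ b) ≤
      (prodBernoulli w).real (openConnIn ({o}ᶜ : Set (Fin n)) (u B) b)) (t : ℝ)
    (hD : 0 < (prodBernoulli (Function.update w s(o, a) 1)).real (openConn c a)ᶜ)
    (hcert :
      (prodBernoulli (Function.update w s(o, a) 1)).real (openConn c a)ᶜ *
          ∑ B ∈ 𝒰.filter (fun B => a ∉ B),
            min (max 0 ((prodBernoulli w).real (openConnIn ({o}ᶜ : Set (Fin n)) c b) -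
                  (prodBernoulli w).real (openConnIn ({o}ᶜ : Set (Fin n)) (v B) b)) *
                (prodBernoulli w).real (starEvent o (↑B : Set (Fin n))))
              ((prodBernoulli w).real (openConn c b ∩ starEvent o (↑B : Set (Fin n))) -
                (prodBernoulli w).real (openConn a₀ b ∩ starEvent o (↑B : Set (Fin n)))) ≤
        (prodBernoulli (Function.update w s(o, a) 1)).real (openConn c a)ᶜ * t *
            (prodBernoulli w).real {ω | ∃ B ∈ 𝒰, ∀ u ∈ B, s(o, u) ∈ ω} +
          (w s(o, a) : ℝ) *
            (prodBernoulli (Function.update w s(o, a) 1)).real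
              ((openConn c a)ᶜ ∩ ({ω | s(o, a) ∈ ω} ∩ {ω | ∃ B ∈ 𝒰, ∀ u ∈ B, s(o, u) ∈ ω})) *
            ((prodBernoulli (Function.update w s(o, a) 1)).real (openConn a b) -
              (prodBernoulli (Function.update w s(o, a) 1)).real (openConn c b))) :
    (prodBernoulli w).real (openConn c b ∩ {ω | ∃ B ∈ 𝒰, ∀ u ∈ B, s(o, u) ∈ ω}) -
        (prodBernoulli w).real (openConn o b ∩ {ω | ∃ B ∈ 𝒰, ∀ u ∈ B, s(o, u) ∈ ω}) ≤
      t * (prodBernoulli w).real {ω | ∃ B ∈ 𝒰, ∀ u ∈ B, s(o, u) ∈ ω} := by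
  set μ := prodBernoulli w with hμ
  set μ₁ := prodBernoulli (Function.update w s(o, a) 1) with hμ₁
  set U : Set (BondConfig (Fin n)) := {ω | ∃ B ∈ 𝒰, ∀ u ∈ B, s(o, u) ∈ ω} with hU
  set Ua : Set (BondConfig (Fin n)) := {ω | s(o, a) ∈ ω} ∩ U with hUa
  have hsc := real_inter_upEvent_split μ s(o, a) (openConn c b) U
  have hso := real_inter_upEvent_split μ s(o, a) (openConn o b) U
  have hbr := onePort_bracket w A o a c b hoA haA 𝒰 h𝒰A
  have hoff := offPort_cells_hybrid w A o a c b a₀ hoA haA hco ha₀o hiso 𝒰 h𝒰A hup v hv u hu hanchor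
  set Dm := μ₁.real (openConn c a)ᶜ with hDm
  set L := ∑ B ∈ 𝒰.filter (fun B => a ∉ B),
      min (max 0 (μ.real (openConnIn ({o}ᶜ : Set (Fin n)) c b) - μ.real (openConnIn ({o}ᶜ : Set (Fin n)) (v B) b)) *
          μ.real (starEvent o (↑B : Set (Fin n))))
        (μ.real (openConn c b ∩ starEvent o (↑B : Set (Fin n))) - μ.real (openConn a₀ b ∩ starEvent o (↑B : Set (Fin n)))) with hL
  set X := μ.real (openConn c b ∩ Ua) - μ.real (openConn o b ∩ Ua) with hX
  set Y := μ.real (openConn c b ∩ U ∩ {ω | s(o, a) ∉ ω}) -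
      μ.real (openConn o b ∩ U ∩ {ω | s(o, a) ∉ ω}) with hY
  set G := (w s(o, a) : ℝ) * μ₁.real ((openConn c a)ᶜ ∩ Ua) *
      (μ₁.real (openConn c b) - μ₁.real (openConn a b)) with hG
  have h1 : Dm * X ≤ G := hbr
  have h2 : Y ≤ L := hoff
  have h3 : Dm * L ≤ Dm * t * μ.real U +
      (w s(o, a) : ℝ) * μ₁.real ((openConn c a)ᶜ ∩ Ua) *
        (μ₁.real (openConn a b) - μ₁.real (openConn c b)) := hcert
  have hG' : (w s(o, a) : ℝ) * μ₁.real ((openConn c a)ᶜ ∩ Ua) *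
        (μ₁.real (openConn a b) - μ₁.real (openConn c b)) = -G := by
    rw [hG]; ring
  rw [hG'] at h3
  have hsum : μ.real (openConn c b ∩ U) - μ.real (openConn o b ∩ U) = X + Y := by
    rw [hsc, hso, hX, hY]; ring
  rw [hsum]
  have h4 : Dm * (X + Y) ≤ Dm * t * μ.real U := by
    have hDm0 : 0 ≤ Dm := measureReal_nonneg
    nlinarith [h1, h2, h3, mul_le_mul_of_nonneg_left h2 hDm0]
  have h5 : Dm * (X + Y) ≤ Dm * (t * μ.real U) := by linarith [h4]
  exact le_of_mul_le_mul_left h5 hD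

end

end Summit.CriticalPhenomena.PercolationContinuityZ3.Theorems
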